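import Mathlib
import Summits.CriticalPhenomena.SAWScalingLimit.Theorems.NoFoldBound.Negative.BoundaryRayFlux

/-!
# The values of the kernel on the support, dart by dart

Crux `NoFoldBound` (stmt-CriticalPhenomena-8296), negative side, sixth support file of the
BOUNDARY-IDENTITY RAY: the 42 evaluations `rayD b m = d₀ + d₁t₁ + d₂t₂ + d₃t₃` of the kernel of
`BoundaryRayKernel.lean` on the (source, dart) pairs entering the 14 nontrivial row identities
(each by `decide` on the table at the integer keys), and the cyclotomic relation
`Φ₄₈(w) = w¹⁶ - w⁸ + 1 = 0` for `w = e^{iπ/24}` used to close the rows. Sorry-free.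
-/

noncomputable section

open Literature.Probability.LatticeModels Literature.Probability.RandomPlanarGeometry.SAW

namespace Summit.CriticalPhenomena.SAWScalingLimit.Theorems.NoFoldBound.Negative.BoundaryRay

/-- **The 48th cyclotomic relation** `w¹⁶ - w⁸ + 1 = 0` for `w = e^{iπ/24}`: `w²⁴ + 1 = (w⁸ + 1)(w¹⁶ - w⁸ + 1)`
and `w⁸ = ω ≠ -1`. -/
theorem phi48 : w24 ^ 16 - w24 ^ 8 + 1 = 0 := by
  have h24 := w24_pow_24
  have hne : w24 ^ 8 + 1 ≠ 0 := by rw [← omg_eq]; exact HV.omg_add_one_ne_zero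
  have hprod : (w24 ^ 8 + 1) * (w24 ^ 16 - w24 ^ 8 + 1) = 0 := by
    linear_combination h24
  exact (mul_eq_zero.1 hprod).resolve_left hne

/-- `D` on the source #10 and the dart #16. -/
theorem rayD_10_16 :
    rayD s(ofHV (0, 2, true), ofHV (0, 3, false)) s(ofHV (-2, 2, true), ofHV (-1, 2, false)) =
      evalT (0, 1, 0, 0) := by
  rw [rayD, ekey_mk, ekey_mk]; simp only [toHV_ofHV]; exact congrArg evalT (by decide)

/-- `D` on the source #10 and the dart #35. -/
theorem rayD_10_35 :
    rayD s(ofHV (0, 2, true), ofHV (0, 3, false)) s(ofHV (3, 0, true), ofHV (3, 0, false)) =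
      evalT (0, 1, 0, 0) := by
  rw [rayD, ekey_mk, ekey_mk]; simp only [toHV_ofHV]; exact congrArg evalT (by decide)

/-- `D` on the source #16 and the dart #10. -/
theorem rayD_16_10 :
    rayD s(ofHV (-1, 2, false), ofHV (-2, 2, true)) s(ofHV (0, 3, false), ofHV (0, 2, true)) =
      evalT (0, 1, 0, 0) := by
  rw [rayD, ekey_mk, ekey_mk]; simp only [toHV_ofHV]; exact congrArg evalT (by decide)

/-- `D` on the source #16 and the dart #32. -/
theorem rayD_16_32 :
    rayD s(ofHV (-1, 2, false), ofHV (-2, 2, true)) s(ofHV (-1, 0, false), ofHV (-1, 0, true)) =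
      evalT (0, 1, 0, 0) := by
  rw [rayD, ekey_mk, ekey_mk]; simp only [toHV_ofHV]; exact congrArg evalT (by decide)

/-- `D` on the source #23 and the dart #24. -/
theorem rayD_23_24 :
    rayD s(ofHV (-1, 1, true), ofHV (0, 1, false)) s(ofHV (0, 1, false), ofHV (0, 0, true)) =
      evalT (-4, 0, 3, 0) := by
  rw [rayD, ekey_mk, ekey_mk]; simp only [toHV_ofHV]; exact congrArg evalT (by decide)

/-- `D` on the source #23 and the dart #55. -/
theorem rayD_23_55 :
    rayD s(ofHV (-1, 1, true), ofHV (0, 1, false)) s(ofHV (3, -3, false), ofHV (2, -3, true)) =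
      evalT (-4, 0, 3, 0) := by
  rw [rayD, ekey_mk, ekey_mk]; simp only [toHV_ofHV]; exact congrArg evalT (by decide)

/-- `D` on the source #24 and the dart #23. -/
theorem rayD_24_23 :
    rayD s(ofHV (0, 0, true), ofHV (0, 1, false)) s(ofHV (0, 1, false), ofHV (-1, 1, true)) =
      evalT (-4, 0, 3, 0) := by
  rw [rayD, ekey_mk, ekey_mk]; simp only [toHV_ofHV]; exact congrArg evalT (by decide)

/-- `D` on the source #24 and the dart #33. -/
theorem rayD_24_33 :
    rayD s(ofHV (0, 0, true), ofHV (0, 1, false)) s(ofHV (1, 0, false), ofHV (0, 0, true)) =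
      evalT (2, 0, 0, 0) := by
  rw [rayD, ekey_mk, ekey_mk]; simp only [toHV_ofHV]; exact congrArg evalT (by decide)

/-- `D` on the source #24 and the dart #49. -/
theorem rayD_24_49 :
    rayD s(ofHV (0, 0, true), ofHV (0, 1, false)) s(ofHV (1, -2, true), ofHV (2, -2, false)) =
      evalT (0, 0, 0, 1) := by
  rw [rayD, ekey_mk, ekey_mk]; simp only [toHV_ofHV]; exact congrArg evalT (by decide)

/-- `D` on the source #24 and the dart #56. -/
theorem rayD_24_56 :
    rayD s(ofHV (0, 0, true), ofHV (0, 1, false)) s(ofHV (3, -3, true), ofHV (3, -2, false)) =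
      evalT (0, 9, 0, -20) := by
  rw [rayD, ekey_mk, ekey_mk]; simp only [toHV_ofHV]; exact congrArg evalT (by decide)

/-- `D` on the source #24 and the dart #60. -/
theorem rayD_24_60 :
    rayD s(ofHV (0, 0, true), ofHV (0, 1, false)) s(ofHV (1, -4, true), ofHV (1, -3, false)) =
      evalT (0, -9, 0, 23) := by
  rw [rayD, ekey_mk, ekey_mk]; simp only [toHV_ofHV]; exact congrArg evalT (by decide)

/-- `D` on the source #32 and the dart #16. -/
theorem rayD_32_16 :
    rayD s(ofHV (-1, 0, true), ofHV (-1, 0, false)) s(ofHV (-2, 2, true), ofHV (-1, 2, false)) =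
      evalT (0, 1, 0, 0) := by
  rw [rayD, ekey_mk, ekey_mk]; simp only [toHV_ofHV]; exact congrArg evalT (by decide)

/-- `D` on the source #32 and the dart #40. -/
theorem rayD_32_40 :
    rayD s(ofHV (-1, 0, true), ofHV (-1, 0, false)) s(ofHV (0, -1, true), ofHV (0, 0, false)) =
      evalT (0, 1, 0, 0) := by
  rw [rayD, ekey_mk, ekey_mk]; simp only [toHV_ofHV]; exact congrArg evalT (by decide)

/-- `D` on the source #33 and the dart #24. -/
theorem rayD_33_24 :
    rayD s(ofHV (0, 0, true), ofHV (1, 0, false)) s(ofHV (0, 1, false), ofHV (0, 0, true)) =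
      evalT (2, 0, 0, 0) := by
  rw [rayD, ekey_mk, ekey_mk]; simp only [toHV_ofHV]; exact congrArg evalT (by decide)

/-- `D` on the source #33 and the dart #40. -/
theorem rayD_33_40 :
    rayD s(ofHV (0, 0, true), ofHV (1, 0, false)) s(ofHV (0, -1, true), ofHV (0, 0, false)) =
      evalT (0, 1, 0, 0) := by
  rw [rayD, ekey_mk, ekey_mk]; simp only [toHV_ofHV]; exact congrArg evalT (by decide)

/-- `D` on the source #33 and the dart #49. -/
theorem rayD_33_49 :
    rayD s(ofHV (0, 0, true), ofHV (1, 0, false)) s(ofHV (1, -2, true), ofHV (2, -2, false)) =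
      evalT (0, 0, 0, 1) := by
  rw [rayD, ekey_mk, ekey_mk]; simp only [toHV_ofHV]; exact congrArg evalT (by decide)

/-- `D` on the source #35 and the dart #10. -/
theorem rayD_35_10 :
    rayD s(ofHV (3, 0, false), ofHV (3, 0, true)) s(ofHV (0, 3, false), ofHV (0, 2, true)) =
      evalT (0, 1, 0, 0) := by
  rw [rayD, ekey_mk, ekey_mk]; simp only [toHV_ofHV]; exact congrArg evalT (by decide)

/-- `D` on the source #35 and the dart #43. -/
theorem rayD_35_43 :
    rayD s(ofHV (3, 0, false), ofHV (3, 0, true)) s(ofHV (4, -1, false), ofHV (3, -1, true)) =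
      evalT (0, 1, 0, 0) := by
  rw [rayD, ekey_mk, ekey_mk]; simp only [toHV_ofHV]; exact congrArg evalT (by decide)

/-- `D` on the source #40 and the dart #32. -/
theorem rayD_40_32 :
    rayD s(ofHV (0, 0, false), ofHV (0, -1, true)) s(ofHV (-1, 0, false), ofHV (-1, 0, true)) =
      evalT (0, 1, 0, 0) := by
  rw [rayD, ekey_mk, ekey_mk]; simp only [toHV_ofHV]; exact congrArg evalT (by decide)

/-- `D` on the source #40 and the dart #33. -/
theorem rayD_40_33 :
    rayD s(ofHV (0, 0, false), ofHV (0, -1, true)) s(ofHV (1, 0, false), ofHV (0, 0, true)) =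
      evalT (0, 1, 0, 0) := by
  rw [rayD, ekey_mk, ekey_mk]; simp only [toHV_ofHV]; exact congrArg evalT (by decide)

/-- `D` on the source #43 and the dart #35. -/
theorem rayD_43_35 :
    rayD s(ofHV (3, -1, true), ofHV (4, -1, false)) s(ofHV (3, 0, true), ofHV (3, 0, false)) =
      evalT (0, 1, 0, 0) := by
  rw [rayD, ekey_mk, ekey_mk]; simp only [toHV_ofHV]; exact congrArg evalT (by decide)

/-- `D` on the source #43 and the dart #56. -/
theorem rayD_43_56 :
    rayD s(ofHV (3, -1, true), ofHV (4, -1, false)) s(ofHV (3, -3, true), ofHV (3, -2, false)) =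
      evalT (0, 1, 0, 0) := by
  rw [rayD, ekey_mk, ekey_mk]; simp only [toHV_ofHV]; exact congrArg evalT (by decide)

/-- `D` on the source #49 and the dart #24. -/
theorem rayD_49_24 :
    rayD s(ofHV (2, -2, false), ofHV (1, -2, true)) s(ofHV (0, 1, false), ofHV (0, 0, true)) =
      evalT (0, 0, 0, 1) := by
  rw [rayD, ekey_mk, ekey_mk]; simp only [toHV_ofHV]; exact congrArg evalT (by decide)

/-- `D` on the source #49 and the dart #33. -/
theorem rayD_49_33 :
    rayD s(ofHV (2, -2, false), ofHV (1, -2, true)) s(ofHV (1, 0, false), ofHV (0, 0, true)) =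
      evalT (0, 0, 0, 1) := by
  rw [rayD, ekey_mk, ekey_mk]; simp only [toHV_ofHV]; exact congrArg evalT (by decide)

/-- `D` on the source #49 and the dart #56. -/
theorem rayD_49_56 :
    rayD s(ofHV (2, -2, false), ofHV (1, -2, true)) s(ofHV (3, -3, true), ofHV (3, -2, false)) =
      evalT (-25, 0, 18, 0) := by
  rw [rayD, ekey_mk, ekey_mk]; simp only [toHV_ofHV]; exact congrArg evalT (by decide)

/-- `D` on the source #49 and the dart #60. -/
theorem rayD_49_60 :
    rayD s(ofHV (2, -2, false), ofHV (1, -2, true)) s(ofHV (1, -4, true), ofHV (1, -3, false)) =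
      evalT (23, 0, -16, 0) := by
  rw [rayD, ekey_mk, ekey_mk]; simp only [toHV_ofHV]; exact congrArg evalT (by decide)

/-- `D` on the source #49 and the dart #62. -/
theorem rayD_49_62 :
    rayD s(ofHV (2, -2, false), ofHV (1, -2, true)) s(ofHV (2, -4, true), ofHV (2, -3, false)) =
      evalT (2, 0, -1, 0) := by
  rw [rayD, ekey_mk, ekey_mk]; simp only [toHV_ofHV]; exact congrArg evalT (by decide)

/-- `D` on the source #55 and the dart #23. -/
theorem rayD_55_23 :
    rayD s(ofHV (2, -3, true), ofHV (3, -3, false)) s(ofHV (0, 1, false), ofHV (-1, 1, true)) =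
      evalT (-4, 0, 3, 0) := by
  rw [rayD, ekey_mk, ekey_mk]; simp only [toHV_ofHV]; exact congrArg evalT (by decide)

/-- `D` on the source #55 and the dart #56. -/
theorem rayD_55_56 :
    rayD s(ofHV (2, -3, true), ofHV (3, -3, false)) s(ofHV (3, -3, true), ofHV (3, -2, false)) =
      evalT (0, 1, 0, -2) := by
  rw [rayD, ekey_mk, ekey_mk]; simp only [toHV_ofHV]; exact congrArg evalT (by decide)

/-- `D` on the source #55 and the dart #62. -/
theorem rayD_55_62 :
    rayD s(ofHV (2, -3, true), ofHV (3, -3, false)) s(ofHV (2, -4, true), ofHV (2, -3, false)) =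
      evalT (0, -2, 0, 5) := by
  rw [rayD, ekey_mk, ekey_mk]; simp only [toHV_ofHV]; exact congrArg evalT (by decide)

/-- `D` on the source #56 and the dart #24. -/
theorem rayD_56_24 :
    rayD s(ofHV (3, -2, false), ofHV (3, -3, true)) s(ofHV (0, 1, false), ofHV (0, 0, true)) =
      evalT (0, 9, 0, -20) := by
  rw [rayD, ekey_mk, ekey_mk]; simp only [toHV_ofHV]; exact congrArg evalT (by decide)

/-- `D` on the source #56 and the dart #43. -/
theorem rayD_56_43 :
    rayD s(ofHV (3, -2, false), ofHV (3, -3, true)) s(ofHV (4, -1, false), ofHV (3, -1, true)) =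
      evalT (0, 1, 0, 0) := by
  rw [rayD, ekey_mk, ekey_mk]; simp only [toHV_ofHV]; exact congrArg evalT (by decide)

/-- `D` on the source #56 and the dart #49. -/
theorem rayD_56_49 :
    rayD s(ofHV (3, -2, false), ofHV (3, -3, true)) s(ofHV (1, -2, true), ofHV (2, -2, false)) =
      evalT (-25, 0, 18, 0) := by
  rw [rayD, ekey_mk, ekey_mk]; simp only [toHV_ofHV]; exact congrArg evalT (by decide)

/-- `D` on the source #56 and the dart #55. -/
theorem rayD_56_55 :
    rayD s(ofHV (3, -2, false), ofHV (3, -3, true)) s(ofHV (3, -3, false), ofHV (2, -3, true)) =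
      evalT (0, 1, 0, -2) := by
  rw [rayD, ekey_mk, ekey_mk]; simp only [toHV_ofHV]; exact congrArg evalT (by decide)

/-- `D` on the source #56 and the dart #62. -/
theorem rayD_56_62 :
    rayD s(ofHV (3, -2, false), ofHV (3, -3, true)) s(ofHV (2, -4, true), ofHV (2, -3, false)) =
      evalT (9, 0, -6, 0) := by
  rw [rayD, ekey_mk, ekey_mk]; simp only [toHV_ofHV]; exact congrArg evalT (by decide)

/-- `D` on the source #60 and the dart #24. -/
theorem rayD_60_24 :
    rayD s(ofHV (1, -3, false), ofHV (1, -4, true)) s(ofHV (0, 1, false), ofHV (0, 0, true)) =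
      evalT (0, -9, 0, 23) := by
  rw [rayD, ekey_mk, ekey_mk]; simp only [toHV_ofHV]; exact congrArg evalT (by decide)

/-- `D` on the source #60 and the dart #49. -/
theorem rayD_60_49 :
    rayD s(ofHV (1, -3, false), ofHV (1, -4, true)) s(ofHV (1, -2, true), ofHV (2, -2, false)) =
      evalT (23, 0, -16, 0) := by
  rw [rayD, ekey_mk, ekey_mk]; simp only [toHV_ofHV]; exact congrArg evalT (by decide)

/-- `D` on the source #60 and the dart #62. -/
theorem rayD_60_62 :
    rayD s(ofHV (1, -3, false), ofHV (1, -4, true)) s(ofHV (2, -4, true), ofHV (2, -3, false)) =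
      evalT (-9, 0, 7, 0) := by
  rw [rayD, ekey_mk, ekey_mk]; simp only [toHV_ofHV]; exact congrArg evalT (by decide)

/-- `D` on the source #62 and the dart #49. -/
theorem rayD_62_49 :
    rayD s(ofHV (2, -3, false), ofHV (2, -4, true)) s(ofHV (1, -2, true), ofHV (2, -2, false)) =
      evalT (2, 0, -1, 0) := by
  rw [rayD, ekey_mk, ekey_mk]; simp only [toHV_ofHV]; exact congrArg evalT (by decide)

/-- `D` on the source #62 and the dart #55. -/
theorem rayD_62_55 :
    rayD s(ofHV (2, -3, false), ofHV (2, -4, true)) s(ofHV (3, -3, false), ofHV (2, -3, true)) =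
      evalT (0, -2, 0, 5) := by
  rw [rayD, ekey_mk, ekey_mk]; simp only [toHV_ofHV]; exact congrArg evalT (by decide)

/-- `D` on the source #62 and the dart #56. -/
theorem rayD_62_56 :
    rayD s(ofHV (2, -3, false), ofHV (2, -4, true)) s(ofHV (3, -3, true), ofHV (3, -2, false)) =
      evalT (9, 0, -6, 0) := by
  rw [rayD, ekey_mk, ekey_mk]; simp only [toHV_ofHV]; exact congrArg evalT (by decide)

/-- `D` on the source #62 and the dart #60. -/
theorem rayD_62_60 :
    rayD s(ofHV (2, -3, false), ofHV (2, -4, true)) s(ofHV (1, -4, true), ofHV (1, -3, false)) =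
      evalT (-9, 0, 7, 0) := by
  rw [rayD, ekey_mk, ekey_mk]; simp only [toHV_ofHV]; exact congrArg evalT (by decide)

end Summit.CriticalPhenomena.SAWScalingLimit.Theorems.NoFoldBound.Negative.BoundaryRay
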